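import Literature.Computability.Complexity.MurrayWilliams2018StringComplexity
import Literature.Computability.Complexity.MurrayWilliams2018AlmostAE
import Literature.Computability.Complexity.MerlinArthurAdvice
import Literature.Computability.Complexity.MurrayWilliams2018EasyWitnessRegimes
import Literature.Computability.Complexity.MurrayWilliams2018Simulation
import Literature.Computability.Complexity.TimeConstructibleClosure
import HarnessLib

/-!
# Murray–Williams 2018, Lemma 4.1 (almost-everywhere form): the assembly of §4 from
# Theorem 3.1 and the derandomised advice simulation

Literature / circuit complexity. The named fact
`Literature.Computability.Complexity.MurrayWilliams2018_lemma_4_1_ae`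
(`MurrayWilliams2018EasyWitness.lean`; C. D. Murray, R. R. Williams, *Circuit lower bounds for
nondeterministic quasi-polytime: an easy witness lemma for NP and NQP*, STOC 2018 = SIAM J.
Comput. 49(5), 2020, Lemma 4.1) is the bottleneck of the cone of `MurrayWilliams2018_NQP_not_ACC`
/ `…_NQP_not_subset_ACC0` / `…_NTIME_not_depth_ACC`. Its printed proof (§4, SIAM pp. 314–316)
is an ASSEMBLY of

* (4.2) the bad inputs of a verifier without small witness circuits — PROVED,
  `exists_verifier_bad_inputs_of_not_NTIMEHasWitnessCircuits`
  (`MurrayWilliams2018StringComplexity.lean`);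
* Theorem 3.1, the "almost" almost-everywhere circuit lower bound for Merlin–Arthur protocols
  with advice, applied to `s'(n) = s(e·n)`, `s'₂ = s'^{d'}`, `s'₁ = s' ∘ s'₂` — its hardness
  analysis is proved abstractly in `MurrayWilliams2018AlmostAE.lean`, its protocol is not yet
  in the tree;
* the derandomised simulation `N` of that protocol: a nondeterministic `O(t(n)ᵉ)`-time machine
  with `(2d′+1)n` bits of advice (a bad input `x_hard` and the protocol's advice) which guesses a
  hard witness `y_hard`, feeds it to Umans' generator (Thm. 2.1/2.3, [Uma03]) and takes the
  majority vote of Arthur's predicate over all seeds — Umans' generator and the machine are not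
  yet in the tree;
* hypothesis (4.1) applied to `N`, hard-wiring of the advice, and the final contradiction.

This file PROVES the assembly — every step of §4 that is not inside Theorem 3.1 or inside the
machine `N` — as the theorem

  `MurrayWilliams2018_lemma_4_1_ae_of_ingredients (h31 : …) (hsim : …) :
     MurrayWilliams2018_lemma_4_1_ae`,

whose two hypotheses are stated inline over notions defined here (no named fact is introduced,
D-0026; both are binders of a conditional theorem, like `hN`/`hB` of
`MurrayWilliams2018{Hierarchy,Headline}.lean`):

* `h31` — **Theorem 3.1 in universal-referee form**, specialised as in §4 to `s₂ = s^{D'}`,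
  `s₁ = (s ∘ s₂)^D` (the printed `s ∘ s₂` with polynomial slack): ONE referee `Ref ∈ P` and ONE exponent `D ≥ 1` such that for every strictly
  increasing time-constructible `s` with `n · s(n)² < 2ⁿ` a.e. and every `D' ≥ D` there are
  advice strings `adv n` of length `≤ D (log₂ s₂(n) + 1)` and a language `L₁` with
  `AdvisedMAGame Ref (mwMoveLen s D D') adv L₁` (Def. 2.1/2.2: the MA promise with the designated
  advice, at move length `(s₁(n) · s₂(n))^D`, game values `amValue` of `ArthurMerlinGames.lean`)
  and, for all large `n`, `s(n) < CC(L₁ⁿ)` or `s(s₂ n) < CC(L₁^{s₂ n})` (`Language.circuitSize`).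
* `hsim` — **the derandomised advice simulation**: for every referee `Ref ∈ P` there are `k, c₀`
  such that for all time-constructible monotone `t`, time-constructible move lengths `m ≤ t`
  (a.e.), advice rate `a`, every verifier `V : NVerifier t L`, hardness function `w`, and every
  advised game `AdvisedMAGame Ref m adv L₁` with `|adv n| ≤ a n` a.e., ONE pair language `N'`
  lies in `NTIME (t^e)` for every `e ≥ k` and, for all large `n`, every bad input `x_h ∈ L` of
  length `n` (all accepted witnesses of string circuit complexity `> w n`, `stringCC`) and every
  `ℓ ≥ n` with `(ℓ + m ℓ)^k ≤ w n`, decides `L₁` on `{0,1}^ℓ` with `c₀ (a+1) ℓ` bits of advice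
  (`DecidesOnWithAdvice`). This is exactly the paragraph "Our next step is to use these bad
  `xᵢ`'s to derandomize the MA protocol defining `L₁` …" of the printed proof, with Umans'
  Theorem 2.3 inside; its proof is a machine construction over `TM2` in the manner of
  `IKWSimulationMachine.lean` plus [Uma03], left to the files that build it.

## Why the universal referee (quantifier order)

`MurrayWilliams2018_lemma_4_1_ae` is `∃ e g d, ∀ s t, …`. Murray–Williams' Theorem 3.1 has
universal constants `d₁, d₂, d₃` and running time `O(s₁(n)² · s₂(n)^{d₃})`, and §4 needs this
uniformity twice: the circuit `Cₓ` simulating "the deterministic `O(s₂(s₂(ℓᵢ)))`-time part of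
`M₁`" must have size polynomial in `s₂(s₂(s₂(nᵢ)))` with an exponent fixed before `s`, `t` (it is
fooled from hardness `w = s₂(s₂(s₂(n)))^{2g}`), and `N`'s running time `O(t^{a+g})` must have an
exponent fixed before `s`, `t`. A class-level rendering "for each `(s, s₁, s₂)` SOME referee in
`P`" (the shape of `MAPromiseAdvice`, `MerlinArthurAdvice.lean`) hides a polynomial whose degree
may depend on `s` and does NOT imply the lemma; the universal-referee form does (the numbers
`s(n)`, `s₂(n)`, `αₙ` travel in the advice, Merlin's circuit is bounded by the message length,
the complete language and its checker are fixed), and it is what the printed theorem asserts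
once "computable by a Merlin–Arthur protocol in `O(s₁² s₂^{d₃})` time" is read with its universal
`O`-exponent. `AdvisedMAGame.mem_MAPromiseAdvice` records that it refines `MAPromiseAdvice`.

## The assembly (proof of `MurrayWilliams2018_lemma_4_1_ae_of_ingredients`)

Constants, fixed before `s, t`: `D' = D² + D + 2`, `a = 2 D D'`, `B = c₀ (a + 1)`, `c = B + 6`,
`e = max k 2c + D'`, `g = k`, `d = 1`. Given `s, t` with the hypotheses of the lemma and, for
contradiction, `L ∈ NTIME t` with a verifier `V` having bad inputs at infinitely many lengths
for `w(n) = S₂³(n)^{2k}`, `S₂ = stretch s e`: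
1. `s'(n) := s(c·n)` is strictly increasing, time constructible
   (`IsTimeConstructible.comp_mul_left`) and small: from (a) `n s(n) < 2^{n/e}` at `c n` and
   `2c ≤ e`, `c n · s'(n) < 2^{n/2}`, so `n · s'(n)² < 2ⁿ` (the printed "`s'(n) = s(e·n) <
   2^{e·n/e}/(e·n)`", with the square needed by the counting form of Thm. 2.8,
   `CountingDiagonalization.lean`). `h31` at `(s', D')` gives `adv`, `L₁`.
2. `m := mwMoveLen s' D D'` is time constructible (`isTimeConstructible_mwMoveLen`, from the
   closure lemmas of `TimeConstructibleClosure.lean`) and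
   `m(ℓ) = (s'(s'₂ ℓ)ᴰ · s'₂ ℓ)ᴰ ≤ s'(s'₂ ℓ)^{D²+D} ≤ s'₂(s'₂ ℓ) ≤ S₂(S₂ ℓ) ≤ S₂³(ℓ) ≤ t(ℓ)`
   a.e. by (b) with `d = 1` (the printed "`s'₁(n)² s'₂(n)^{d₃} ≤ s'₂(s'₂(n)) ≤ s₂(s₂(n))`" and
   constraint (b)); the advice is linear,
   `|adv n| ≤ a n` a.e. (the printed "`2 log s'₂(n) < 2d'·n`"). `hsim` gives `N' ∈ NTIME(tᵉ)`.
3. Hypothesis (4.1) for `N'` at the pair lengths `M(ℓ) = 2ℓ + Bℓ + 2` of `ℓ = n` and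
   `ℓ = s'₂(n)`, hard-wiring the advice (`MWSim.circuitSize_le_of_slice_agree` of
   `MurrayWilliams2018Simulation.lean`: `+ 2` gates, `Circuit.exists_hardwire`): `CC(L₁^ℓ) ≤ s(M ℓ) + 2 ≤ s(M ℓ + 2) ≤ s(c ℓ) = s'(ℓ)` by strict
   monotonicity and `c ≥ B + 6` (the printed "`N` … has circuits of size `s((2d′+2)n)`" and
   "`e ≥ 2d' + 2`"), the guards `(ℓ + m ℓ)^k ≤ w n` holding at both lengths because
   `m(s'₂ n) ≤ s'₂³(n) ≤ S₂³(n)` and `2 S₂³(n) ≤ S₂³(n)²`.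
4. At a large bad length `n` this contradicts the disjunction of `h31` (the printed (4.3)/(4.4)).

## Contents

* `AdvisedMAGame Ref m adv L` (MW Def. 2.1/2.2 for a named referee), `AdvisedMAGame.mem_MAPromiseAdvice`,
  `mem_MAPromiseAdvice_iff_exists_advisedMAGame`;
* `DecidesOnWithAdvice N B L ℓ` (MW §2, advice classes, one length: `N` decides `L` on `{0,1}^ℓ`
  with `B ℓ` bits of advice), `DecidesOnWithAdvice.circuitSize_le` (advice folding, from
  `MWSim.circuitSize_le_of_slice_agree`);
* `mwMoveLen s D D'` (the move length `(s₁ s₂)^D` of §4), `isTimeConstructible_mwMoveLen`;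
* arithmetic: `add_le_apply_add_of_strictMono`, `pow_le_pow_right_of_one_le` (the growth of
  `stretch` is `stretch_monotone`, `id_le_stretch` of `MurrayWilliams2018EasyWitnessRegimes.lean`);
* `MurrayWilliams2018_lemma_4_1_ae_of_ingredients`; `h31_of_thm_3_1_universal` (the §4
  specialisation `s₂ = s^{D'}`, `s₁ = s ∘ s₂` from Theorem 3.1 with general time-constructible
  `s₁, s₂` under (i)–(iii), by the closure lemmas) and
  `MurrayWilliams2018_lemma_4_1_ae_of_thm_3_1_universal_of_simulation`.

What is NOT here (and why the fact stays undischarged): the protocol of Theorem 3.1 (needs a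
paddable, downward self-reducible, same-length-checkable complete language — Santhanam 2007 /
Trevisan–Vadhan, or a `#P`-style substitute — and its Merlin–Arthur referee), and the machine
`N` with Umans' generator. On the latter: for the `∃ e`-form a generator of seed `O(log |Y|)`
at EVERY hardness level is necessary — from (4.1) one only gets `t(n) < 2^{O(s log s)}`; for
`t ≤ S₂³(n)^{O(1)}` the Nisan–Wigderson line of the tree would do, for `t ≥ 2^{S₂²(n)^{O(1)}}`
brute force over Arthur's coins refutes (4.1) outright, but in between the hardness
`S₂³(n)^{2g}` is only polynomial to subexponential in `log |Y|` and Nisan–Wigderson seeds are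
`ω(log |Y|)` (review item 4 of `MurrayWilliams2018EasyWitness.lean`: a re-cut at Lemma 1.3 avoids
this).

## References

* C. D. Murray, R. R. Williams, *Circuit lower bounds for nondeterministic quasi-polytime: an
  easy witness lemma for NP and NQP*, STOC 2018, 890–901 = SIAM J. Comput. 49(5) (2020),
  STOC18-300–322: §2 (advice classes; Def. 2.1, 2.2; Thm. 2.3 = Umans), Thm. 3.1, Lemma 4.1 and
  its proof (SIAM pp. 314–316, displays (4.1)–(4.4)) [MurrayWilliams2018].
* C. Umans, *Pseudo-random generators for all hardnesses*, J. Comput. Syst. Sci. 67 (2003)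
  419–440, Thm. 1 [Uma03, cited through MW Thm. 2.3].
* S. Arora, B. Barak, *Computational Complexity: A Modern Approach*, CUP 2009, §1.3
  (time-constructible functions), Def. 6.16 (advice), Def. 8.10 (`MA`) [AroraBarakCC2009].
-/

noncomputable section

namespace Literature.Computability.Complexity

open _root_.Computability Filter AMPlayer

/-! ### Advised Merlin–Arthur games with a named referee (MW Def. 2.1/2.2) -/

/-- **The MA promise with designated advice, for a named referee** (Murray–Williams 2018,
Def. 2.1: "`L ∈ MA/a(n)` if there is a polynomial-time algorithm `V` … and … strings `{αₙ}` with
`|αₙ| ≤ a(n)` … if `x ∈ L` then for some `y`, `Pr_z[V(x,y,z,αₙ) accepts] ≥ 2/3`; if `x ∉ L`, then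
for all `y`, `… ≤ 1/3`. Note that the MA conditions are only guaranteed to hold when `V` is
equipped with the correct advice"; Def. 2.2: the promise on all lengths). Over the tree's
Arthur–Merlin games (`amValue`, `ArthurMerlinGames.lean`; the shape of `MAPromiseAdvice`,
`MerlinArthurAdvice.lean`, with the referee `Ref` and the advice `adv` NAMED rather than
existentially hidden): on every input `x`, in the two-move game `[merlin, arthur]` with moves of
length `m |x|` played on `⟨x, adv |x|⟩`, Merlin's winning chance is `≥ 2/3` if `x ∈ L` and
`≤ 1/3` if `x ∉ L`. [cite: MurrayWilliams2018, Definition 2.1–2.2] -/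
def AdvisedMAGame (Ref : Language Bool) (m : ℕ → ℕ) (adv : ℕ → List Bool) (L : Language Bool) :
    Prop :=
  ∀ x : List Bool,
    (x ∈ L → (2 / 3 : ℝ) ≤ amValue Ref (m x.length) [merlin, arthur] (boolPair x (adv x.length))) ∧
    (x ∉ L → amValue Ref (m x.length) [merlin, arthur] (boolPair x (adv x.length)) ≤ 1 / 3)

/-- `MAPromiseAdvice m a` is the class of languages with SOME referee in `P` and SOME advice of
length `≤ a` satisfying `AdvisedMAGame` (definitional). [cite: MurrayWilliams2018, Definition 2.1] -/
theorem mem_MAPromiseAdvice_iff_exists_advisedMAGame {m a : ℕ → ℕ} {L : Language Bool} :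
    L ∈ MAPromiseAdvice m a ↔ ∃ Ref ∈ Classes.P, ∃ adv : ℕ → List Bool,
      (∀ n, (adv n).length ≤ a n) ∧ AdvisedMAGame Ref m adv L :=
  Iff.rfl

/-- An advised game with a polynomial-time referee and advice of length `≤ a` puts `L` in
`MAPromiseAdvice m a`. [cite: MurrayWilliams2018, Definition 2.1] -/
theorem AdvisedMAGame.mem_MAPromiseAdvice {Ref : Language Bool} {m a : ℕ → ℕ}
    {adv : ℕ → List Bool} {L : Language Bool} (h : AdvisedMAGame Ref m adv L)
    (hRef : Ref ∈ Classes.P) (hadv : ∀ n, (adv n).length ≤ a n) : L ∈ MAPromiseAdvice m a :=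
  ⟨Ref, hRef, adv, hadv, h⟩

/-! ### Deciding one slice with linear advice (MW §2, advice classes) -/

/-- **`N` decides `L` on length `ℓ` with `B ℓ` bits of advice** (Murray–Williams 2018, §2:
"`𝒞/a(n)` is the class of languages `L` such that there is an `L' ∈ 𝒞` and an arbitrary function
`f : ℕ → {0,1}*` with `|f(n)| ≤ a(n)` … `L = {x | (x, f(|x|)) ∈ L'}`. That is, the arbitrary
advice string `f(n)` can be used to solve all `n`-bit instances within class `𝒞`"), one length
at a time and with the advice of length EXACTLY `B ℓ` (so that all advised inputs `⟨x, β⟩`,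
`|x| = ℓ`, have the same length `2ℓ + 2 + Bℓ`): some `β` with `|β| = B ℓ` satisfies
`x ∈ L ⟺ ⟨x, β⟩ ∈ N` for all `x ∈ {0,1}^ℓ`. [cite: MurrayWilliams2018, §2 (advice classes)] -/
def DecidesOnWithAdvice (N : Language Bool) (B : ℕ) (L : Language Bool) (ℓ : ℕ) : Prop :=
  ∃ β : List Bool, β.length = B * ℓ ∧ ∀ x : List Bool, x.length = ℓ → (x ∈ L ↔ boolPair x β ∈ N)

/-! ### Hard-wiring the advice -/

/-- **From advice to circuits**: if `N` decides `L` on length `ℓ` with `B ℓ` bits of advice then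
`CC(L^ℓ) ≤ N.circuitSize (2ℓ + Bℓ + 2) + 2` — hard-wire the advice into an optimal circuit for the
slice of `N` at the pair length (`MWSim.circuitSize_le_of_slice_agree`,
`MurrayWilliams2018Simulation.lean`: two constant gates, `Circuit.exists_hardwire`; the printed
"`N` (using `(2d′+1)n` bits of advice) … has circuits of size `s((2d′+2)n)`").
[cite: MurrayWilliams2018, Lemma 4.1 (proof)] -/
theorem DecidesOnWithAdvice.circuitSize_le {N L : Language Bool} {B ℓ : ℕ}
    (h : DecidesOnWithAdvice N B L ℓ) :
    L.circuitSize ℓ ≤ N.circuitSize (2 * ℓ + B * ℓ + 2) + 2 := by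
  obtain ⟨β, hβ, hiff⟩ := h
  rw [← hβ]
  exact MWSim.circuitSize_le_of_slice_agree β ℓ hiff

/-! ### The move length of the protocol of Theorem 3.1 at `s₁ = (s ∘ s₂)^D`, `s₂ = s^{D'}` -/

/-- **Murray–Williams' move length** (time scale of the protocol of Thm. 3.1, "computable by a
Merlin–Arthur protocol in `O(s₁(n)² · s₂(n)^{d₃})` time", with one exponent `D` for all universal
constants, move length `(s₁(n) · s₂(n))^D`), at the specialisation `s₂ = s^{D'}`,
`s₁ = (s ∘ s₂)^D` (the printed `s′₁ = s′ ∘ s′₂` with polynomial slack, so that constraints of the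
shape (ii) `s(s₂ n)ᴰ ≤ s₁(n)` — e.g. the tree's `s(s₂ n) + 2 ≤ s₁(n)`, `MurrayWilliams2018AlmostAE.lean`
— are met): `mwMoveLen s D D' n = (s (s n ^ D') ^ D · s n ^ D') ^ D`.
[cite: MurrayWilliams2018, Thm. 3.1 and Lemma 4.1 (proof)] -/
def mwMoveLen (s : ℕ → ℕ) (D D' : ℕ) (n : ℕ) : ℕ := (s (s n ^ D') ^ D * s n ^ D') ^ D

/-- Unfolding of `mwMoveLen` (definitional). [folklore] -/
@[simp] theorem mwMoveLen_apply (s : ℕ → ℕ) (D D' n : ℕ) :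
    mwMoveLen s D D' n = (s (s n ^ D') ^ D * s n ^ D') ^ D := rfl

/-- **The move length is time constructible** for time-constructible `s` and `D, D' ≥ 1`
(powers, composition and products of time-constructible functions,
`TimeConstructibleClosure.lean`), so that the simulating machine can lay out Merlin's message
and Arthur's coins. [cite: AroraBarakCC2009, §1.3 (p. 16)] -/
theorem isTimeConstructible_mwMoveLen {s : ℕ → ℕ} (hs : IsTimeConstructible s) {D D' : ℕ}
    (hD : 1 ≤ D) (hD' : 1 ≤ D') : IsTimeConstructible (mwMoveLen s D D') := by
  have h₂ : IsTimeConstructible fun n => s n ^ D' := hs.pow hD'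
  have h₁ : IsTimeConstructible fun n => s (s n ^ D') := h₂.comp hs
  exact ((h₁.pow hD).mul h₂).pow hD

/-! ### Arithmetic -/

/-- A strictly increasing `s : ℕ → ℕ` gains at least `j` over `j` steps: `s a + j ≤ s (a + j)`.
[folklore] -/
theorem add_le_apply_add_of_strictMono {s : ℕ → ℕ} (hs : StrictMono s) (a j : ℕ) :
    s a + j ≤ s (a + j) := by
  induction j with
  | zero => simp
  | succ j ih =>
    have h1 : s (a + j) < s (a + j + 1) := hs (Nat.lt_succ_self (a + j))
    have h2 : a + (j + 1) = a + j + 1 := by omega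
    rw [h2]
    omega

/-- Monotonicity of powers in the exponent from `1` on, including the base `0`. [folklore] -/
theorem pow_le_pow_right_of_one_le {b n m : ℕ} (hn : 1 ≤ n) (hnm : n ≤ m) : b ^ n ≤ b ^ m := by
  rcases Nat.eq_zero_or_pos b with rfl | hb
  · rw [zero_pow (by omega), zero_pow (by omega)]
  · exact Nat.pow_le_pow_right hb hnm

/-! ### The assembly -/

/-- **Murray–Williams 2018, Lemma 4.1 (a.e. form) from Theorem 3.1 and the derandomised advice
simulation.** See the module docstring for the two hypotheses (`h31`: Thm. 3.1 in
universal-referee form at `s₁ = s ∘ s₂`, `s₂ = s^{D'}`; `hsim`: the advice-taking `NTIME(tᵉ)`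
simulation of an advised MA game armed with the hard witnesses of a bad input) and for the
constants `D' = D²+D+2`, `a = 2DD'`, `B = c₀(a+1)`, `c = B + 6`, `e = max k 2c + D'`, `g = k`,
`d = 1`. The proof is §4 of the source: stretch `s'(n) = s(c n)`, apply `h31`, bound the move
length and the advice, apply `hsim`, apply hypothesis (4.1) to the simulating pair language at
the pair lengths of `n` and `s'₂(n)`, hard-wire the advice, and contradict the hardness of `L₁`
at a large bad length. [cite: MurrayWilliams2018, Lemma 4.1 (proof)] -/
theorem MurrayWilliams2018_lemma_4_1_ae_of_ingredients
    (h31 : ∃ Ref : Language Bool, Ref ∈ Classes.P ∧ ∃ D : ℕ, 1 ≤ D ∧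
      ∀ (s : ℕ → ℕ) (D' : ℕ), D * D + D + 2 ≤ D' → StrictMono s → IsTimeConstructible s →
        (∀ᶠ n in atTop, n * s n ^ 2 < 2 ^ n) →
        ∃ (adv : ℕ → List Bool) (L₁ : Language Bool),
          (∀ n, (adv n).length ≤ D * (Nat.log 2 (s n ^ D') + 1)) ∧
          AdvisedMAGame Ref (mwMoveLen s D D') adv L₁ ∧
          ∀ᶠ n in atTop, s n < L₁.circuitSize n ∨ s (s n ^ D') < L₁.circuitSize (s n ^ D'))
    (hsim : ∀ Ref : Language Bool, Ref ∈ Classes.P → ∃ k c₀ : ℕ, 1 ≤ k ∧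
      ∀ (t m : ℕ → ℕ) (a : ℕ), IsTimeConstructible t → Monotone t → IsTimeConstructible m →
        (∀ᶠ n in atTop, m n ≤ t n) →
        ∀ {L : Language Bool} (V : NVerifier t L) (w : ℕ → ℕ) (adv : ℕ → List Bool)
          (L₁ : Language Bool),
          (∀ᶠ n in atTop, (adv n).length ≤ a * n) → AdvisedMAGame Ref m adv L₁ →
          ∃ N' : Language Bool, (∀ e : ℕ, k ≤ e → N' ∈ NTIME (fun n => t n ^ e)) ∧
            ∀ᶠ n in atTop, ∀ xh : List Bool, xh ∈ L → xh.length = n →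
              (∀ y : List Bool, y.length ≤ V.c * t xh.length + V.c → V.rel xh y = true →
                w xh.length < stringCC y) →
              ∀ ℓ : ℕ, n ≤ ℓ → (ℓ + m ℓ) ^ k ≤ w n → DecidesOnWithAdvice N' (c₀ * (a + 1)) L₁ ℓ) :
    MurrayWilliams2018_lemma_4_1_ae := by
  obtain ⟨Ref, hRef, D, hD, H31⟩ := h31
  obtain ⟨k, c₀, hk, HS⟩ := hsim Ref hRef
  -- the constants, all fixed before `s` and `t`
  obtain ⟨D', hD'⟩ : ∃ D' : ℕ, D' = D * D + D + 2 := ⟨_, rfl⟩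
  obtain ⟨a, ha⟩ : ∃ a : ℕ, a = 2 * D * D' := ⟨_, rfl⟩
  obtain ⟨B, hB⟩ : ∃ B : ℕ, B = c₀ * (a + 1) := ⟨_, rfl⟩
  obtain ⟨c, hc⟩ : ∃ c : ℕ, c = B + 6 := ⟨_, rfl⟩
  obtain ⟨e, he⟩ : ∃ e : ℕ, e = max k (2 * c) + D' := ⟨_, rfl⟩
  have hke : k ≤ e := by rw [he]; exact (le_max_left _ _).trans (Nat.le_add_right _ _)
  have h2ce : 2 * c ≤ e := by rw [he]; exact (le_max_right _ _).trans (Nat.le_add_right _ _)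
  have hD'e : D' ≤ e := by rw [he]; exact Nat.le_add_left _ _
  have hD'1 : 1 ≤ D' := by rw [hD']; omega
  have hDD' : D ≤ D' := by rw [hD']; nlinarith
  have hDD'2 : (D + 1) * D ≤ D' := by rw [hD']; nlinarith
  have hc1 : 1 ≤ c := by omega
  have hce : c ≤ e := by omega
  have he1 : 1 ≤ e := by omega
  refine ⟨e, k, 1, he1, hk, le_rfl, ?_⟩
  intro s t hs hsc htc hmono hsa hsb h41
  by_contra hW
  obtain ⟨L, -, V, hbad⟩ := exists_verifier_bad_inputs_of_not_NTIMEHasWitnessCircuits hW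
  -- the stretched size functions `s'(n) = s(c n)`, `s'₂ = s'^{D'}`, `S₂ = stretch s e`
  obtain ⟨s', hs'def⟩ : ∃ s' : ℕ → ℕ, s' = fun n => s (c * n) := ⟨_, rfl⟩
  obtain ⟨s₂', hs₂'def⟩ : ∃ s₂' : ℕ → ℕ, s₂' = fun n => s' n ^ D' := ⟨_, rfl⟩
  obtain ⟨S₂, hS₂def⟩ : ∃ S₂ : ℕ → ℕ, S₂ = stretch s e := ⟨_, rfl⟩
  have hs'ap : ∀ n, s' n = s (c * n) := fun n => by rw [hs'def]
  have hs₂'ap : ∀ n, s₂' n = s' n ^ D' := fun n => by rw [hs₂'def]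
  have hS₂ap : ∀ n, S₂ n = s (e * n) ^ e := fun n => by rw [hS₂def, stretch_apply]
  have hS₃ : ∀ n, (stretch s e)^[3] n = S₂ (S₂ (S₂ n)) := fun n => by rw [hS₂def]; rfl
  have hs' : StrictMono s' := fun x y hxy => by
    rw [hs'ap, hs'ap]; exact hs (Nat.mul_lt_mul_of_pos_left hxy hc1)
  have hs'c : IsTimeConstructible s' := by rw [hs'def]; exact hsc.comp_mul_left hc1
  have hS₂mono : Monotone S₂ := by rw [hS₂def]; exact stretch_monotone hs.monotone e
  have hleS₂ : ∀ n, n ≤ S₂ n := fun n => by rw [hS₂def]; exact id_le_stretch hs he1 n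
  have hles' : ∀ n, n ≤ s' n := fun n =>
    (Nat.le_mul_of_pos_left n hc1).trans (by rw [hs'ap]; exact hs.id_le _)
  have hles₂' : ∀ n, n ≤ s₂' n := fun n => by
    rw [hs₂'ap]; exact (hles' n).trans (Nat.le_self_pow (by omega) _)
  have hs₂'S₂ : ∀ x, s₂' x ≤ S₂ x := fun x => by
    rw [hs₂'ap, hS₂ap, hs'ap]
    calc s (c * x) ^ D' ≤ s (e * x) ^ D' :=
          Nat.pow_le_pow_left (hs.monotone (Nat.mul_le_mul_right x hce)) D'
      _ ≤ s (e * x) ^ e := pow_le_pow_right_of_one_le hD'1 hD'e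
  -- the move length `m = (s'(s'₂ n) · s'₂ n)^D ≤ s'₂ (s'₂ n) ≤ S₂ (S₂ n)`
  obtain ⟨m, hmdef⟩ : ∃ m : ℕ → ℕ, m = mwMoveLen s' D D' := ⟨_, rfl⟩
  have hmc : IsTimeConstructible m := by rw [hmdef]; exact isTimeConstructible_mwMoveLen hs'c hD hD'1
  have hm_le : ∀ ℓ, m ℓ ≤ s₂' (s₂' ℓ) := fun ℓ => by
    rw [hmdef, mwMoveLen_apply, hs₂'ap, hs₂'ap]
    calc (s' (s' ℓ ^ D') ^ D * s' ℓ ^ D') ^ D ≤ (s' (s' ℓ ^ D') ^ D * s' (s' ℓ ^ D')) ^ D :=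
          Nat.pow_le_pow_left (Nat.mul_le_mul_left _ (hles' _)) D
      _ = s' (s' ℓ ^ D') ^ ((D + 1) * D) := by rw [← pow_succ, ← pow_mul]
      _ ≤ s' (s' ℓ ^ D') ^ D' := pow_le_pow_right_of_one_le (by nlinarith) hDD'2
  have hs₂'s₂' : ∀ ℓ, s₂' (s₂' ℓ) ≤ S₂ (S₂ ℓ) := fun ℓ =>
    (hs₂'S₂ _).trans (hS₂mono (hs₂'S₂ ℓ))
  have hmS : ∀ ℓ, m ℓ ≤ S₂ (S₂ (S₂ ℓ)) := fun ℓ =>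
    ((hm_le ℓ).trans (hs₂'s₂' ℓ)).trans (hleS₂ _)
  have hmt : ∀ᶠ n in atTop, m n ≤ t n := by
    filter_upwards [hsb] with n hn
    rw [pow_one, hS₃] at hn
    exact (hmS n).trans hn
  -- smallness of `s'`: `c n · s'(n) < 2^{n/2}`
  have hsmall : ∀ᶠ n in atTop, n * s' n ^ 2 < 2 ^ n := by
    obtain ⟨N₀, hN₀⟩ := eventually_atTop.1 hsa
    refine eventually_atTop.2 ⟨N₀, fun n hn => ?_⟩
    have hcn : N₀ ≤ c * n := hn.trans (Nat.le_mul_of_pos_left n hc1)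
    have h1 : c * n * s (c * n) < 2 ^ (c * n / e) := hN₀ _ hcn
    have h2 : c * n / e ≤ n / 2 :=
      calc c * n / e ≤ c * n / (2 * c) := Nat.div_le_div_left h2ce (by omega)
        _ = n / 2 := by rw [mul_comm 2 c, Nat.mul_div_mul_left n 2 (by omega)]
    have h3 : c * n * s' n < 2 ^ (n / 2) := by
      rw [hs'ap]; exact lt_of_lt_of_le h1 (Nat.pow_le_pow_right (by norm_num) h2)
    have h4 : (c * n * s' n) ^ 2 < (2 ^ (n / 2)) ^ 2 := Nat.pow_lt_pow_left h3 (by norm_num)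
    have h5 : (2 ^ (n / 2)) ^ 2 ≤ 2 ^ n := by
      rw [← pow_mul]; exact Nat.pow_le_pow_right (by norm_num) (by omega)
    have h6 : n * s' n ^ 2 ≤ (c * n * s' n) ^ 2 := by
      rw [mul_pow]
      refine Nat.mul_le_mul_right _ ?_
      calc n ≤ c * n := Nat.le_mul_of_pos_left n hc1
        _ ≤ (c * n) ^ 2 := Nat.le_self_pow two_ne_zero _
    omega
  -- Theorem 3.1 at `s'`
  obtain ⟨adv, L₁, hadv, hgame, hhard⟩ := H31 s' D' (by rw [hD']) hs' hs'c hsmall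
  -- the advice is linear
  have hs'lt : ∀ᶠ n in atTop, s' n < 2 ^ n := by
    filter_upwards [hsmall, eventually_ge_atTop 1] with n h hn
    have : s' n ≤ n * s' n ^ 2 :=
      (Nat.le_self_pow two_ne_zero _).trans (Nat.le_mul_of_pos_left _ hn)
    omega
  have hadv' : ∀ᶠ n in atTop, (adv n).length ≤ a * n := by
    filter_upwards [hs'lt, eventually_ge_atTop 1] with n hlt hn
    have hlog : Nat.log 2 (s' n ^ D') ≤ D' * n := by
      rcases Nat.eq_zero_or_pos (s' n ^ D') with h0 | hpos
      · rw [h0, Nat.log_zero_right]; exact Nat.zero_le _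
      · have hlt' : s' n ^ D' < 2 ^ (D' * n) :=
          calc s' n ^ D' < (2 ^ n) ^ D' := Nat.pow_lt_pow_left hlt (by omega)
            _ = 2 ^ (D' * n) := by rw [← pow_mul, mul_comm]
        exact ((Nat.log_lt_iff_lt_pow one_lt_two hpos.ne').2 hlt').le
    calc (adv n).length ≤ D * (Nat.log 2 (s' n ^ D') + 1) := hadv n
      _ ≤ D * (D' * n + 1) := Nat.mul_le_mul_left D (by omega)
      _ ≤ a * n := by rw [ha]; nlinarith
  -- the derandomised simulation
  obtain ⟨N', hN', hdec⟩ := HS t m a htc hmono hmc hmt V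
    (fun n => ((stretch s e)^[3] n) ^ (2 * k)) adv L₁ hadv' (by rw [hmdef]; exact hgame)
  -- hypothesis (4.1) for `N'`, at the pair lengths of `n` and of `s'₂ n`
  have h41N : ∀ᶠ M in atTop, N'.circuitSize M ≤ s M := h41 N' (hN' e hke)
  have hMtend : Tendsto (fun ℓ : ℕ => 2 * ℓ + B * ℓ + 2) atTop atTop :=
    tendsto_atTop_mono (fun ℓ => show ℓ ≤ 2 * ℓ + B * ℓ + 2 by omega) tendsto_id
  have hs₂tend : Tendsto s₂' atTop atTop := tendsto_atTop_mono hles₂' tendsto_id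
  have h41a : ∀ᶠ n in atTop, N'.circuitSize (2 * n + B * n + 2) ≤ s (2 * n + B * n + 2) :=
    hMtend.eventually h41N
  have h41b : ∀ᶠ n in atTop,
      N'.circuitSize (2 * s₂' n + B * s₂' n + 2) ≤ s (2 * s₂' n + B * s₂' n + 2) :=
    hs₂tend.eventually h41a
  -- the guards of the simulation at `ℓ = n` and `ℓ = s'₂ n`
  have hG : ∀ᶠ n in atTop, (n + m n) ^ k ≤ ((stretch s e)^[3] n) ^ (2 * k) ∧
      (s₂' n + m (s₂' n)) ^ k ≤ ((stretch s e)^[3] n) ^ (2 * k) := by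
    filter_upwards [eventually_ge_atTop 2] with n hn
    rw [hS₃]
    have hS3 : 2 ≤ S₂ (S₂ (S₂ n)) := hn.trans ((hleS₂ n).trans ((hleS₂ _).trans (hleS₂ _)))
    have key : ∀ x, x ≤ S₂ (S₂ (S₂ n)) + S₂ (S₂ (S₂ n)) → x ^ k ≤ S₂ (S₂ (S₂ n)) ^ (2 * k) := by
      intro x hx
      rw [pow_mul]
      refine Nat.pow_le_pow_left (hx.trans ?_) k
      rw [pow_two]
      nlinarith
    constructor
    · refine key _ (Nat.add_le_add ((hleS₂ n).trans ((hleS₂ _).trans (hleS₂ _))) (hmS n))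
    · refine key _ (Nat.add_le_add ?_ ?_)
      · exact (hs₂'S₂ n).trans ((hleS₂ _).trans (hleS₂ _))
      · calc m (s₂' n) ≤ s₂' (s₂' (s₂' n)) := hm_le _
          _ ≤ S₂ (s₂' (s₂' n)) := hs₂'S₂ _
          _ ≤ S₂ (S₂ (S₂ n)) := hS₂mono (hs₂'s₂' n)
  -- a large bad length with all of the above
  obtain ⟨n, ⟨x, hxL, hxn, hxbad⟩, hhard_n, hdec_n, h41a_n, h41b_n, ⟨hG1, hG2⟩, hn2⟩ :=
    (hbad.and_eventually (hhard.and (hdec.and (h41a.and (h41b.and (hG.and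
      (eventually_ge_atTop 2))))))).exists
  -- small circuits for `L₁` at `n` and at `s'₂ n`
  have hfold : ∀ ℓ, 1 ≤ ℓ → s (2 * ℓ + B * ℓ + 2) + 2 ≤ s' ℓ := fun ℓ hℓ =>
    calc s (2 * ℓ + B * ℓ + 2) + 2 ≤ s (2 * ℓ + B * ℓ + 2 + 2) := add_le_apply_add_of_strictMono hs _ 2
      _ ≤ s (c * ℓ) := hs.monotone (by rw [hc]; nlinarith)
      _ = s' ℓ := (hs'ap ℓ).symm
  have d₁ : DecidesOnWithAdvice N' (c₀ * (a + 1)) L₁ n := hdec_n x hxL hxn hxbad n le_rfl hG1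
  have d₂ : DecidesOnWithAdvice N' (c₀ * (a + 1)) L₁ (s₂' n) :=
    hdec_n x hxL hxn hxbad (s₂' n) (hles₂' n) hG2
  have c₁ : L₁.circuitSize n ≤ s' n :=
    calc L₁.circuitSize n ≤ N'.circuitSize (2 * n + c₀ * (a + 1) * n + 2) + 2 := d₁.circuitSize_le
      _ ≤ s (2 * n + B * n + 2) + 2 := by rw [← hB]; exact Nat.add_le_add_right h41a_n 2
      _ ≤ s' n := hfold n (by omega)
  have c₂ : L₁.circuitSize (s₂' n) ≤ s' (s₂' n) :=
    calc L₁.circuitSize (s₂' n) ≤ N'.circuitSize (2 * s₂' n + c₀ * (a + 1) * s₂' n + 2) + 2 :=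
          d₂.circuitSize_le
      _ ≤ s (2 * s₂' n + B * s₂' n + 2) + 2 := by rw [← hB]; exact Nat.add_le_add_right h41b_n 2
      _ ≤ s' (s₂' n) := hfold (s₂' n) ((show 1 ≤ n by omega).trans (hles₂' n))
  -- contradiction with the hardness of `L₁`
  rw [← hs₂'ap] at hhard_n
  rcases hhard_n with h | h
  · exact absurd c₁ (not_le.2 h)
  · exact absurd c₂ (not_le.2 h)

/-! ### From Theorem 3.1 with general `s₁, s₂` to the specialised hypothesis `h31` -/

/-- Polynomial slack: for a strictly increasing `s`, eventually `(n + s n + 2)^D ≤ s n ^ (D + 1)`.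
[folklore] -/
theorem eventually_add_pow_le_pow_succ {s : ℕ → ℕ} (hs : StrictMono s) (D : ℕ) :
    ∀ᶠ n in atTop, (n + s n + 2) ^ D ≤ s n ^ (D + 1) := by
  filter_upwards [eventually_ge_atTop (3 ^ D + 2)] with n hn
  have hsn : n ≤ s n := hs.id_le n
  have h3D : 1 ≤ 3 ^ D := Nat.one_le_pow _ _ (by norm_num)
  have h3 : n + s n + 2 ≤ 3 * s n := by omega
  calc (n + s n + 2) ^ D ≤ (3 * s n) ^ D := Nat.pow_le_pow_left h3 D
    _ = 3 ^ D * s n ^ D := by rw [mul_pow]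
    _ ≤ s n * s n ^ D := Nat.mul_le_mul_right _ (by omega)
    _ = s n ^ (D + 1) := by ring

/-- **The specialisation of §4.** Theorem 3.1 in universal-referee form with GENERAL
time-constructible `s₁, s₂` — one exponent `D` for the universal constants, the constraints read
generously and EVENTUALLY: (i) `(n + s(n) + 2)^D ≤ s₂(n)` (covering `s(n)^{2d₂} ≤ s₂(n)` and
`n ≤ s₂(n)`), (ii) `s(s₂ n)^D ≤ s₁(n)` (covering `s(s₂ n) ≤ s₁(n)` and the tree's
`s(s₂ n) + 2 ≤ s₁(n)` of `MurrayWilliams2018AlmostAE.lean`), (iii) `(n + s(n) + 2)^D ≤ s₁(n)`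
(covering `s(n)^{2d₁+1} ≤ s₁(n)` and the downward-self-reduction overhead
`q(n + s(n) + 2) ≤ s₁(n)` of `MurrayWilliams2018DSR.lean` for `deg q ≤ D` up to constants the
prover absorbs in `D`), the game at move length `(s₁(n) · s₂(n))^D` and advice
`≤ D (log₂ s₂(n) + 1)` — yields the hypothesis `h31` of
`MurrayWilliams2018_lemma_4_1_ae_of_ingredients`: take `s₂ = s^{D'}`, `s₁ = (s ∘ s₂)^D` for
`D' ≥ D² + D + 2` ("Let us check that the functions `s′, s′₁, s′₂` satisfy the constraints of
Theorem 3.1 …", SIAM p. 314), time constructible by `IsTimeConstructible.pow/comp`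
(`TimeConstructibleClosure.lean`), the constraints holding eventually by
`eventually_add_pow_le_pow_succ`. [cite: MurrayWilliams2018, Lemma 4.1 (proof)] -/
theorem h31_of_thm_3_1_universal
    (h : ∃ Ref : Language Bool, Ref ∈ Classes.P ∧ ∃ D : ℕ, 1 ≤ D ∧
      ∀ (s s₁ s₂ : ℕ → ℕ), StrictMono s → IsTimeConstructible s →
        (∀ᶠ n in atTop, n * s n ^ 2 < 2 ^ n) →
        IsTimeConstructible s₁ → IsTimeConstructible s₂ →
        (∀ᶠ n in atTop, (n + s n + 2) ^ D ≤ s₂ n) → (∀ᶠ n in atTop, s (s₂ n) ^ D ≤ s₁ n) →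
        (∀ᶠ n in atTop, (n + s n + 2) ^ D ≤ s₁ n) →
        ∃ (adv : ℕ → List Bool) (L₁ : Language Bool),
          (∀ n, (adv n).length ≤ D * (Nat.log 2 (s₂ n) + 1)) ∧
          AdvisedMAGame Ref (fun n => (s₁ n * s₂ n) ^ D) adv L₁ ∧
          ∀ᶠ n in atTop, s n < L₁.circuitSize n ∨ s (s₂ n) < L₁.circuitSize (s₂ n)) :
    ∃ Ref : Language Bool, Ref ∈ Classes.P ∧ ∃ D : ℕ, 1 ≤ D ∧
      ∀ (s : ℕ → ℕ) (D' : ℕ), D * D + D + 2 ≤ D' → StrictMono s → IsTimeConstructible s →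
        (∀ᶠ n in atTop, n * s n ^ 2 < 2 ^ n) →
        ∃ (adv : ℕ → List Bool) (L₁ : Language Bool),
          (∀ n, (adv n).length ≤ D * (Nat.log 2 (s n ^ D') + 1)) ∧
          AdvisedMAGame Ref (mwMoveLen s D D') adv L₁ ∧
          ∀ᶠ n in atTop, s n < L₁.circuitSize n ∨ s (s n ^ D') < L₁.circuitSize (s n ^ D') := by
  obtain ⟨Ref, hRef, D, hD, H⟩ := h
  refine ⟨Ref, hRef, D, hD, fun s D' hDD' hs hsc hsmall => ?_⟩
  have hD1 : D + 1 ≤ D' := by nlinarith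
  have hD' : 1 ≤ D' := by omega
  have h₂ : IsTimeConstructible fun n => s n ^ D' := hsc.pow hD'
  have h₁ : IsTimeConstructible fun n => s (s n ^ D') ^ D := (h₂.comp hsc).pow hD
  have hslack := eventually_add_pow_le_pow_succ hs D
  -- (i): `(n + s n + 2)^D ≤ s n ^ (D+1) ≤ s n ^ D'`
  have hi : ∀ᶠ n in atTop, (n + s n + 2) ^ D ≤ s n ^ D' := by
    filter_upwards [hslack] with n hn
    exact hn.trans (pow_le_pow_right_of_one_le (by omega) hD1)
  -- (iii): `s n ^ D' ≤ s (s n ^ D') ≤ s (s n ^ D') ^ D`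
  have hiii : ∀ᶠ n in atTop, (n + s n + 2) ^ D ≤ s (s n ^ D') ^ D := by
    filter_upwards [hi] with n hn
    exact hn.trans ((hs.id_le _).trans (Nat.le_self_pow (by omega) _))
  obtain ⟨adv, L₁, hadv, hgame, hhard⟩ := H s (fun n => s (s n ^ D') ^ D) (fun n => s n ^ D')
    hs hsc hsmall h₁ h₂ hi (Eventually.of_forall fun n => le_rfl) hiii
  exact ⟨adv, L₁, hadv, hgame, hhard⟩

/-- **Lemma 4.1 (a.e. form) from Theorem 3.1 in universal-referee form (general `s₁, s₂`) and the
derandomised advice simulation.** [cite: MurrayWilliams2018, Lemma 4.1] -/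
theorem MurrayWilliams2018_lemma_4_1_ae_of_thm_3_1_universal_of_simulation
    (h31 : ∃ Ref : Language Bool, Ref ∈ Classes.P ∧ ∃ D : ℕ, 1 ≤ D ∧
      ∀ (s s₁ s₂ : ℕ → ℕ), StrictMono s → IsTimeConstructible s →
        (∀ᶠ n in atTop, n * s n ^ 2 < 2 ^ n) →
        IsTimeConstructible s₁ → IsTimeConstructible s₂ →
        (∀ᶠ n in atTop, (n + s n + 2) ^ D ≤ s₂ n) → (∀ᶠ n in atTop, s (s₂ n) ^ D ≤ s₁ n) →
        (∀ᶠ n in atTop, (n + s n + 2) ^ D ≤ s₁ n) →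
        ∃ (adv : ℕ → List Bool) (L₁ : Language Bool),
          (∀ n, (adv n).length ≤ D * (Nat.log 2 (s₂ n) + 1)) ∧
          AdvisedMAGame Ref (fun n => (s₁ n * s₂ n) ^ D) adv L₁ ∧
          ∀ᶠ n in atTop, s n < L₁.circuitSize n ∨ s (s₂ n) < L₁.circuitSize (s₂ n))
    (hsim : ∀ Ref : Language Bool, Ref ∈ Classes.P → ∃ k c₀ : ℕ, 1 ≤ k ∧
      ∀ (t m : ℕ → ℕ) (a : ℕ), IsTimeConstructible t → Monotone t → IsTimeConstructible m →
        (∀ᶠ n in atTop, m n ≤ t n) →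
        ∀ {L : Language Bool} (V : NVerifier t L) (w : ℕ → ℕ) (adv : ℕ → List Bool)
          (L₁ : Language Bool),
          (∀ᶠ n in atTop, (adv n).length ≤ a * n) → AdvisedMAGame Ref m adv L₁ →
          ∃ N' : Language Bool, (∀ e : ℕ, k ≤ e → N' ∈ NTIME (fun n => t n ^ e)) ∧
            ∀ᶠ n in atTop, ∀ xh : List Bool, xh ∈ L → xh.length = n →
              (∀ y : List Bool, y.length ≤ V.c * t xh.length + V.c → V.rel xh y = true →
                w xh.length < stringCC y) →
              ∀ ℓ : ℕ, n ≤ ℓ → (ℓ + m ℓ) ^ k ≤ w n → DecidesOnWithAdvice N' (c₀ * (a + 1)) L₁ ℓ) :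
    MurrayWilliams2018_lemma_4_1_ae :=
  MurrayWilliams2018_lemma_4_1_ae_of_ingredients (h31_of_thm_3_1_universal h31) hsim

end Literature.Computability.Complexity

end
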